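import Summits.AtomisticToContinuum.FouriersLaw.Theses.CageBudgetFekete
import Summits.AtomisticToContinuum.FouriersLaw.Theorems.EmbeddedDrudeMourreAbelThermodynamicLimitRegularDLRUnique
import Literature.MathematicalPhysics.KineticTheory.InfiniteChainAbelWitness
import Literature.MathematicalPhysics.KineticTheory.InfiniteChainSuperstableReversal
import Literature.MathematicalPhysics.KineticTheory.InfiniteChainPartialMomentumReversal
import Literature.MathematicalPhysics.KineticTheory.InfiniteChainCurrentMoments
import Literature.MathematicalPhysics.KineticTheory.InfiniteChainGibbsExistenceShift

/-!
# `CageBudgetFekete.UnboundedHeatVariance` / Negative (1): the two junk-excluding hypotheses are load-bearing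

Support file (`--supports stmt-AtomisticToContinuum-15771`) written by the crux-attack refuter of the crux
`Summit.AtomisticToContinuum.FouriersLaw.Theses.CageBudgetFekete.UnboundedHeatVariance` (U: in the guarded arena
of route CageBudgetFekete the equilibrium heat variance `V(τ) = 2∫₀^τ (τ-s) C(s) ds` is unbounded). The crux is
NOT refuted (it is the positivity half of Fourier's law for the clean pinned quartic chain, an open problem);
this file lands what the degenerate-witness attacks establish WITH CERTAINTY about its interface:

* `preservesMeasure_iff` — read-back: `D.PreservesMeasure μ` is the conjunction of (a) `μ`-a.e. membership in
  the carrier of `D` (the ONLY clause tying the flow to the equations of motion, since `InfiniteChainDynamics`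
  constrains `flow` on `carrier` alone) and (b) measure preservation of every `flow t`.
* `exists_frozen_junk_dynamics` — for ANY chain, ANY measure `μ` and ANY `μ`-preserving, shift-commuting map
  `F` with integrable / summable static current products, the structure `⟨∅, fun _ => F, …⟩` is an
  `InfiniteChainDynamics` satisfying clause (b), shift-covariance, `HasAbsConvergentCorrelation` at every time
  and continuity of `C` (which is the constant `∑ₓ ∫ j₀ · (jₓ ∘ F) dμ`); if that constant is `≤ 0` then `V ≤ 0`.
* `unboundedHeatVariance_false_without_carrierAE` — U with clause (a) deleted is FALSE: at
  `ω₂ = lam = β = γ = T = 1`, in the (existing, landed) shift- and reversal-invariant superstable DLR state, take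
  `F = momentumReversalZ` (which preserves the state, commutes with the shift and flips every bond current) or
  `F = id`, whichever makes the frozen correlation constant `∓c₀` non-positive. Any proof of U must therefore USE
  that `μ`-a.e. orbit of `D` solves Newton's equations; measure preservation + all the symmetries do not.
* `unboundedHeatVariance_false_without_gibbs` — U with "DLR Gibbs state at `T`" weakened to "probability
  measure" is FALSE: the Dirac mass at rest with the rest dynamics (`InfiniteChainAbelWitness` §3) satisfies
  every other hypothesis with `C ≡ 0`, `V ≡ 0`.

No new definitions; the weakened statements are spelled inline. refuter-rattack-stmt-AtomisticToContinuum-15771-0,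
2026-08-17.
-/

noncomputable section

namespace Summit.AtomisticToContinuum.FouriersLaw.Theorems.UnboundedHeatVariance.Negative

open MeasureTheory Filter Set Topology
open Literature.MathematicalPhysics.KineticTheory.HeatConduction
open Summit.AtomisticToContinuum.FouriersLaw.Theses

/-! ## §0 Read-back -/

/-- `PreservesMeasure` = (a.e. in the carrier) ∧ (every time-`t` map preserves `μ`). [folklore] -/
theorem preservesMeasure_iff {P : OscillatorChain} (D : InfiniteChainDynamics P) (μ : Measure ChainConfig) :
    D.PreservesMeasure μ ↔ (∀ᵐ σ ∂μ, σ ∈ D.carrier) ∧ ∀ t : ℝ, MeasurePreserving (D.flow t) μ μ :=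
  Iff.rfl

/-! ## §1 Frozen junk dynamics -/

/-- **Frozen junk dynamics.** For any chain `P`, measure `μ` and map `F` preserving `μ`, commuting with the
shift, with integrable static products `j₀ · (jₓ ∘ F)` whose integrals are absolutely summable, the structure
with EMPTY carrier and time-independent flow `F` is an `InfiniteChainDynamics P` (all four dynamical fields are
vacuous) whose every `flow t` preserves `μ`, commutes with the shift, has absolutely convergent correlations,
and whose summed correlation `C` is the constant `c = ∑ₓ ∫ j₀ (jₓ ∘ F) dμ`, hence continuous; if `c ≤ 0` the
heat variance `2∫_{(0,τ]} (τ-s) C(s) ds` is `≤ 0` for every `τ`. [folklore] -/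
theorem exists_frozen_junk_dynamics (P : OscillatorChain) (μ : Measure ChainConfig)
    (F : ChainConfig → ChainConfig) (hF : MeasurePreserving F μ μ)
    (hFs : ∀ σ, F (shift σ) = shift (F σ))
    (hint : ∀ x : ℤ, Integrable (fun σ => P.bondCurrentZ σ 0 * P.bondCurrentZ (F σ) x) μ)
    (hsum : Summable fun x : ℤ => |∫ σ, P.bondCurrentZ σ 0 * P.bondCurrentZ (F σ) x ∂μ|)
    (hc : ∑' x : ℤ, ∫ σ, P.bondCurrentZ σ 0 * P.bondCurrentZ (F σ) x ∂μ ≤ 0) :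
    ∃ D : InfiniteChainDynamics P,
      (∀ t : ℝ, MeasurePreserving (D.flow t) μ μ) ∧
      (∀ (t : ℝ) (σ : ChainConfig), D.flow t (shift σ) = shift (D.flow t σ)) ∧
      (∀ t : ℝ, D.HasAbsConvergentCorrelation μ t) ∧
      Continuous (fun t : ℝ => D.currentCorrelation μ t) ∧
      ∀ τ : ℝ, 2 * ∫ s in Set.Ioc (0:ℝ) τ, (τ - s) * D.currentCorrelation μ s ≤ 0 := by
  refine ⟨⟨∅, fun _ => F, fun _ => mapsTo_empty _ _, fun _ h => (notMem_empty _ h).elim,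
      fun _ h => (notMem_empty _ h).elim, fun _ hγ _ _ => (notMem_empty _ (hγ 0)).elim⟩,
    fun _ => hF, fun _ σ => hFs σ, fun _ => ⟨hint, hsum⟩, ?_, fun τ => ?_⟩
  · change Continuous fun _ : ℝ => ∑' x : ℤ, ∫ σ, P.bondCurrentZ σ 0 * P.bondCurrentZ (F σ) x ∂μ
    exact continuous_const
  have hI : ∫ s in Set.Ioc (0:ℝ) τ,
      (τ - s) * ∑' x : ℤ, ∫ σ, P.bondCurrentZ σ 0 * P.bondCurrentZ (F σ) x ∂μ ≤ 0 :=
    setIntegral_nonpos measurableSet_Ioc fun s hs =>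
      mul_nonpos_of_nonneg_of_nonpos (sub_nonneg.2 hs.2) hc
  change 2 * ∫ s in Set.Ioc (0:ℝ) τ,
      (τ - s) * ∑' x : ℤ, ∫ σ, P.bondCurrentZ σ 0 * P.bondCurrentZ (F σ) x ∂μ ≤ 0
  linarith

/-! ## §2 The a.e.-carrier clause is load-bearing -/

/-- **U without the a.e.-carrier clause is false.** Replace `D.PreservesMeasure μ` by its second clause
`∀ t, MeasurePreserving (D.flow t) μ μ` in `CageBudgetFekete.UnboundedHeatVariance`: the resulting statement
fails at `ω₂ = lam = β = γ = 1`, `T = 1`, for the shift-invariant superstable DLR state `μ` (unique in its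
class, hence momentum-reversal invariant) and the frozen junk dynamics with flow `momentumReversalZ` or `id`
(carrier `∅`): its correlation function is the constant `∓∑ₓ ∫ j₀ jₓ dμ`, one of which is `≤ 0`, so
`V ≤ 0` on `[0, ∞)` and `R = 0` is never exceeded. [folklore] -/
theorem unboundedHeatVariance_false_without_carrierAE :
    ¬ (∀ ω₂ lam β γ : ℝ, 0 < ω₂ → 0 < lam → 0 < β → ∀ T : ℝ, 0 < T →
        ∀ μ : MeasureTheory.Measure ChainConfig,
          (pinnedChain ω₂ lam β γ).IsChainGibbsMeasure T μ → IsShiftInvariant μ →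
          μ.map (fun σ : ChainConfig => fun x : ℤ => ((σ x).1, -(σ x).2)) = μ →
          ∀ D : InfiniteChainDynamics (pinnedChain ω₂ lam β γ),
            (∀ t : ℝ, MeasurePreserving (D.flow t) μ μ) →
            (∀ t : ℝ, ∀ᵐ σ ∂μ, D.flow t (shift σ) = shift (D.flow t σ)) →
            (∀ t : ℝ, D.HasAbsConvergentCorrelation μ t) →
            Continuous (fun t : ℝ => D.currentCorrelation μ t) →
            ∀ V : ℝ → ℝ, V = (fun τ : ℝ => 2 * ∫ s in Set.Ioc (0:ℝ) τ, (τ - s) * D.currentCorrelation μ s) →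
              ∀ R : ℝ, ∃ τ : ℝ, 0 ≤ τ ∧ R < V τ) := by
  intro h
  set P := pinnedChain 1 1 1 1 with hP
  obtain ⟨μ, hG, hS, hss⟩ :=
    OscillatorChain.exists_isChainGibbsMeasure_shiftInvariant_superstable_pinnedChain (1:ℝ) one_pos
      zero_le_one zero_le_one one_pos (ω₂ := 1) (lam := 1) (β := 1) (T := 1)
  -- reversal invariance from DLR uniqueness in the regular class (landed)
  have hR : μ.map momentumReversalZ = μ :=
    OscillatorChain.map_momentumReversalZ_eq_of_regular_unique hG hS hss
      (AbelThermodynamicLimit.LoomisCompactHorizonWitness.stub_regularDLRUnique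
        1 1 1 1 one_pos one_pos one_pos one_pos 1 one_pos)
  have hRmp : MeasurePreserving momentumReversalZ μ μ :=
    OscillatorChain.measurePreserving_momentumReversalZ_of_map_eq hR
  -- static integrability / summability along a μ-preserving map
  have hU0 : ∀ r, 0 ≤ P.U r := OscillatorChain.pinnedChain_U_nonneg 1 1 zero_le_one zero_le_one
  have hUm : Measurable P.U := OscillatorChain.measurable_pinnedChain_U 1 1 1 1
  have hV := OscillatorChain.pinnedChain_isEvenPolyOfDegree_V (1:ℝ) (1:ℝ) (1:ℝ) (β := 1) one_pos
  have hintF : ∀ {F : ChainConfig → ChainConfig}, MeasurePreserving F μ μ →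
      ∀ x : ℤ, Integrable (fun σ => P.bondCurrentZ σ 0 * P.bondCurrentZ (F σ) x) μ :=
    fun hF x => hss.integrable_bondCurrentZ_mul_comp one_le_two hU0 hUm hV hF x 0
  have hsum_id : Summable fun x : ℤ => |∫ σ, P.bondCurrentZ σ 0 * P.bondCurrentZ σ x ∂μ| :=
    hG.summable_abs_integral_bondCurrentZ_mul
  have hflip : ∀ x : ℤ, ∫ σ, P.bondCurrentZ σ 0 * P.bondCurrentZ (momentumReversalZ σ) x ∂μ =
      -∫ σ, P.bondCurrentZ σ 0 * P.bondCurrentZ σ x ∂μ := fun x => by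
    rw [← integral_neg]
    refine integral_congr_ae (Eventually.of_forall fun σ => ?_)
    simp only [bondCurrentZ_momentumReversalZ, mul_neg]
  have hsum_flip : Summable fun x : ℤ =>
      |∫ σ, P.bondCurrentZ σ 0 * P.bondCurrentZ (momentumReversalZ σ) x ∂μ| :=
    hsum_id.congr fun x => by rw [hflip x, abs_neg]
  set c₀ : ℝ := ∑' x : ℤ, ∫ σ, P.bondCurrentZ σ 0 * P.bondCurrentZ σ x ∂μ with hc₀
  have hcflip : ∑' x : ℤ, ∫ σ, P.bondCurrentZ σ 0 * P.bondCurrentZ (momentumReversalZ σ) x ∂μ = -c₀ := by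
    rw [hc₀, ← tsum_neg]
    exact tsum_congr hflip
  -- the frozen junk dynamics with non-positive correlation constant
  obtain ⟨D, hmp, hcov, hAC, hcont, hVle⟩ : ∃ D : InfiniteChainDynamics P,
      (∀ t : ℝ, MeasurePreserving (D.flow t) μ μ) ∧
      (∀ (t : ℝ) (σ : ChainConfig), D.flow t (shift σ) = shift (D.flow t σ)) ∧
      (∀ t : ℝ, D.HasAbsConvergentCorrelation μ t) ∧
      Continuous (fun t : ℝ => D.currentCorrelation μ t) ∧
      ∀ τ : ℝ, 2 * ∫ s in Set.Ioc (0:ℝ) τ, (τ - s) * D.currentCorrelation μ s ≤ 0 := by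
    rcases le_total c₀ 0 with hle | hge
    · exact exists_frozen_junk_dynamics P μ id (MeasurePreserving.id μ) (fun _ => rfl)
        (hintF (MeasurePreserving.id μ)) hsum_id hle
    · exact exists_frozen_junk_dynamics P μ momentumReversalZ hRmp
        (fun σ => (shift_momentumReversalZ σ).symm) (hintF hRmp) hsum_flip (by rw [hcflip]; linarith)
  obtain ⟨τ, -, hτ⟩ := h 1 1 1 1 one_pos one_pos one_pos 1 one_pos μ hG hS hR D hmp
    (fun t => Eventually.of_forall (hcov t)) hAC hcont _ rfl 0
  exact absurd (hVle τ) (not_le.2 hτ)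

/-! ## §3 The DLR (Gibbs) hypothesis is load-bearing -/

/-- **U with "Gibbs state" weakened to "probability measure" is false.** The Dirac mass at the rest
configuration is shift- and reversal-invariant and is preserved by the rest dynamics (carrier `{rest}`,
identity flow — a genuine `InfiniteChainDynamics` of `pinnedChain`, since `U'(0) = 0`), whose correlations
vanish identically: `C ≡ 0`, `V ≡ 0`, and `R = 0` is never exceeded. The DLR property (non-atomic
coordinates, `not_isChainGibbsMeasure_dirac`) is what excludes this witness. [folklore] -/
theorem unboundedHeatVariance_false_without_gibbs :
    ¬ (∀ ω₂ lam β γ : ℝ, 0 < ω₂ → 0 < lam → 0 < β → ∀ T : ℝ, 0 < T →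
        ∀ μ : MeasureTheory.Measure ChainConfig,
          IsProbabilityMeasure μ → IsShiftInvariant μ →
          μ.map (fun σ : ChainConfig => fun x : ℤ => ((σ x).1, -(σ x).2)) = μ →
          ∀ D : InfiniteChainDynamics (pinnedChain ω₂ lam β γ),
            D.PreservesMeasure μ →
            (∀ t : ℝ, ∀ᵐ σ ∂μ, D.flow t (shift σ) = shift (D.flow t σ)) →
            (∀ t : ℝ, D.HasAbsConvergentCorrelation μ t) →
            Continuous (fun t : ℝ => D.currentCorrelation μ t) →
            ∀ V : ℝ → ℝ, V = (fun τ : ℝ => 2 * ∫ s in Set.Ioc (0:ℝ) τ, (τ - s) * D.currentCorrelation μ s) →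
              ∀ R : ℝ, ∃ τ : ℝ, 0 ≤ τ ∧ R < V τ) := by
  intro h
  set P := pinnedChain 1 1 1 1 with hP
  have hU : deriv P.U 0 = 0 := deriv_U_pinnedChain_zero 1 1 1 1
  have hrev : (Measure.dirac restConfig).map (fun σ : ChainConfig => fun x : ℤ => ((σ x).1, -(σ x).2)) =
      Measure.dirac restConfig := by
    change (Measure.dirac restConfig).map momentumReversalZ = Measure.dirac restConfig
    rw [Measure.map_dirac' momentumReversalZ.measurable]
    congr 1
    funext x
    simp [restConfig]
  have hC : ∀ t : ℝ, (P.restDynamics hU).currentCorrelation (Measure.dirac restConfig) t = 0 :=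
    OscillatorChain.currentCorrelation_restDynamics P hU
  obtain ⟨τ, -, hτ⟩ := h 1 1 1 1 one_pos one_pos one_pos 1 one_pos (Measure.dirac restConfig)
    inferInstance isShiftInvariant_dirac_rest hrev (P.restDynamics hU)
    (P.restDynamics_preserves_dirac hU) (fun t => Eventually.of_forall fun σ => rfl)
    (P.hasAbsConvergentCorrelation_restDynamics hU) (by simp only [hC]; exact continuous_const) _ rfl 0
  simp only [hC, mul_zero, integral_zero] at hτ
  exact lt_irrefl _ hτ

end Summit.AtomisticToContinuum.FouriersLaw.Theorems.UnboundedHeatVariance.Negative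

end
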